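import Mathlib
import Summits.CriticalPhenomena.CardyFormulaZ2.Theorems.CardySelfRefinementDefs
import Summits.CriticalPhenomena.CardyFormulaZ2.Theorems.CardySelfRefinementRussoDriftPolynomial
import Summits.CriticalPhenomena.CardyFormulaZ2.Theorems.CardySelfRefinementTrivialSectorRateStubSixArmSectorMassLocality
import Literature.Probability.Percolation.PivotalCell
import HarnessLib

/-!
# Block counting for stub `stub_boundaryRelevance` (line `far-field-is-a-quarter-turn`, crux
`TrivialSectorRate`, stmt-CriticalPhenomena-10266): the `min 1` branch of boundary relevance and
the reduction of (HB) to the scales below `1/η`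

(HB) is the hypothesis `hB` of the tree mass theorems `weightedPivotalMass_of_factorisation` and
`sixArmSectorMass_corrected`: `∑_{u ∈ U, bdist u < 2Dη} M_k(γ s)(Rel k m F η u D) ≤ C₀ D² min(1, (Dη)^b)`
with `b > 0`, for all `s`, small `η`, `D ≥ 1` and finite `U`.  This file proves, for EVERY finite
quad family `F` (no regularity of the quads) and every parameter point:

* `exists_carrier_subset_closedBall` — the carriers lie in a common closed ball `B̄(0, ρ)`;
* `norm_lt_of_Rel_nonempty` — a block `u` whose lattice `D`-box is relevant (`Rel u D ≠ ∅`) has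
  its drawn centre `η·z(k•u)` within `ρ + 1 + 2√2|η|(D+1)` of the origin (contrapositive of
  `Rel_eq_empty_of_le_infDist`: a relevant box meets the window, the `1`-thickening of a carrier);
* `mem_box_of_Rel_nonempty` — hence `u ∈ box 2 ⌊(ρ+1)/η + 3(D+1)⌋₊` (`k ≥ 1`, `η > 0`);
* `sum_real_Rel_le` — **BLOCK COUNTING**: `∑_{u ∈ U} M_k(ρ',c)(Rel u D) ≤ C_F (D + η⁻¹)²` for all
  parameters, all `η > 0`, `D ≥ 1` and finite `U` (`C_F = (2ρ+15)²`: each term is `≤ 1` and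
  vanishes off the box, which has `(2⌊…⌋₊+1)² ≤ (2ρ+15)²(D+η⁻¹)²` sites);
* `sum_real_Rel_le_sq` — the `min 1` branch of (HB): for `Dη ≥ 1` the FULL sum is `≤ 4 C_F D²`;
* `boundaryRelevance_of_small_scales` (registered helper) — **(HB) for `(k, γ, F)` follows from
  its restriction to the scales `Dη < 1`** with the bound `C D² (Dη)^b`;
* `boundaryRelevance_small_of_count_of_decay` — a sufficient condition for that restriction: a
  boundary block count `#{u ∈ U : bdist u < 2Dη} ≤ L D η⁻¹` (finite upper Minkowski content of the
  quad boundaries at the scales `≥ η`) times a UNIFORM per-box decay `M(Rel u D) ≤ C (Dη)^{1+b}` of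
  the boundary boxes (half-plane three-arm exponent `> 1`).  Caution: at a marked corner of a quad
  of interior angle `θ ≥ π` the nearest boxes only decay like `(Dη)^{π/θ} ≤ Dη` (two alternating
  arms in the wedge), so for such quads the uniform decay fails and (HB) has to be summed directly.

Not here and not in the tree: any decay of `M_k(γ s)(Rel u D)` for boundary boxes, i.e. boundary
arm exponents of the self-refinement model along the path (for bond-`ℤ²` at `½` the tree has the
axis half-plane three-arm window bound `Z2HalfPlane.real_threeArm_le`, exponent `1 + α`).
-/

noncomputable section

namespace Summit.CriticalPhenomena.CardyFormulaZ2.Theorems.CardySelfRefinement.FarField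

open scoped Topology
open Filter Set MeasureTheory
open Literature.Probability.LatticeModels Literature.Probability.Percolation
open Literature.Probability.Percolation.QuadCrossing
open Summit.CriticalPhenomena.CardyFormulaZ2.Theses.CardySelfRefinement

/-! ## Geometry: blocks with a relevant box lie in a bounded lattice box -/

/-- The carriers of a finite quad family lie in a common closed ball about the origin. -/
theorem exists_carrier_subset_closedBall (m : ℕ) (F : Fin m → Quad (univ : Set ℂ)) :
    ∃ ρ : ℝ, 0 ≤ ρ ∧ ∀ i, (F i).carrier ⊆ Metric.closedBall (0 : ℂ) ρ := by
  obtain ⟨R, hR⟩ :=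
    (isCompact_iUnion fun i => (F i).isCompact_carrier).isBounded.subset_closedBall (0 : ℂ)
  exact ⟨max R 0, le_max_right _ _, fun i =>
    (Set.subset_iUnion (fun i => (F i).carrier) i).trans
      (hR.trans (Metric.closedBall_subset_closedBall (le_max_left _ _)))⟩

/-- A block whose lattice `D`-box is relevant has its drawn centre `η·z(k•u)` within
`ρ + 1 + 2√2|η|(D+1)` of the origin, when all carriers lie in `B̄(0,ρ)` (contrapositive of
`Rel_eq_empty_of_le_infDist`: every carrier is at distance `≥ ‖η·z(k•u)‖ - ρ` from the centre). -/
theorem norm_lt_of_Rel_nonempty {m : ℕ} {F : Fin m → Quad (univ : Set ℂ)} {ρ : ℝ}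
    (hρ : ∀ i, (F i).carrier ⊆ Metric.closedBall (0 : ℂ) ρ) (k : ℕ) (η : ℝ) (u : Site 2) (D : ℕ)
    (h : (Rel k m F η u D).Nonempty) :
    ‖(η : ℂ) * squareLatticeEmbedding.z (ctr k u)‖ < ρ + 1 + 2 * Real.sqrt 2 * |η| * (D + 1) := by
  refine not_le.1 fun hge => ?_
  have hempty : Rel k m F η u D = ∅ := by
    refine Rel_eq_empty_of_le_infDist k m F η u D fun i => ?_
    have hne : ((F i).carrier).Nonempty := Set.range_nonempty _
    refine (Metric.le_infDist hne).2 fun y hy => ?_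
    have hy' : ‖y‖ ≤ ρ := mem_closedBall_zero_iff.1 (hρ i hy)
    have h1 : ‖(η : ℂ) * squareLatticeEmbedding.z (ctr k u)‖ - ‖y‖ ≤
        dist ((η : ℂ) * squareLatticeEmbedding.z (ctr k u)) y := by
      rw [dist_eq_norm]
      exact norm_sub_norm_le _ _
    linarith
  rw [hempty] at h
  exact Set.not_nonempty_empty h

/-- `2√2 < 3`. -/
private theorem two_mul_sqrt_two_lt_three : 2 * Real.sqrt 2 < 3 := by
  nlinarith [Real.sq_sqrt (show (0 : ℝ) ≤ 2 by norm_num), Real.sqrt_nonneg 2]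

/-- With all carriers in `B̄(0,ρ)`, `k ≥ 1` and `η > 0`: a block whose lattice `D`-box is
relevant lies in the lattice box of radius `⌊(ρ+1)/η + 3(D+1)⌋₊` (coordinates are bounded by the
norm of the drawn site, `abs_coord_le_norm_z`, and `|u i| ≤ k |u i|`). -/
theorem mem_box_of_Rel_nonempty {m : ℕ} {F : Fin m → Quad (univ : Set ℂ)} {ρ : ℝ}
    (hρ : ∀ i, (F i).carrier ⊆ Metric.closedBall (0 : ℂ) ρ) {k : ℕ} (hk : 0 < k) {η : ℝ}
    (hη : 0 < η) (u : Site 2) (D : ℕ) (h : (Rel k m F η u D).Nonempty) :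
    u ∈ box 2 ⌊(ρ + 1) / η + 3 * (D + 1)⌋₊ := by
  have hlt := norm_lt_of_Rel_nonempty hρ k η u D h
  rw [norm_mul, Complex.norm_real, Real.norm_eq_abs, abs_of_pos hη] at hlt
  have hz : ‖squareLatticeEmbedding.z (ctr k u)‖ < (ρ + 1) / η + 3 * (D + 1) := by
    have h1 : ‖squareLatticeEmbedding.z (ctr k u)‖ < (ρ + 1) / η + 2 * Real.sqrt 2 * (D + 1) := by
      rw [div_add' _ _ _ hη.ne', lt_div_iff₀ hη]
      linarith
    have h2 : 2 * Real.sqrt 2 * ((D : ℝ) + 1) ≤ 3 * (D + 1) := by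
      have := two_mul_sqrt_two_lt_three
      have hD : (0 : ℝ) ≤ D + 1 := by positivity
      nlinarith
    linarith
  set T : ℝ := (ρ + 1) / η + 3 * (D + 1) with hT
  have hfl : T < (⌊T⌋₊ : ℝ) + 1 := Nat.lt_floor_add_one T
  have hk1 : (1 : ℝ) ≤ k := by exact_mod_cast hk
  rw [mem_box]
  intro i
  have hcoord : |((ctr k u i : ℤ) : ℝ)| ≤ ‖squareLatticeEmbedding.z (ctr k u)‖ :=
    abs_coord_le_norm_z _ i
  have hki : ((ctr k u i : ℤ) : ℝ) = (k : ℝ) * (u i : ℝ) := by simp [ctr]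
  rw [hki, abs_mul, abs_of_nonneg (by positivity : (0 : ℝ) ≤ k)] at hcoord
  have hui : |(u i : ℝ)| < T := by
    have : |(u i : ℝ)| ≤ (k : ℝ) * |(u i : ℝ)| := le_mul_of_one_le_left (abs_nonneg _) hk1
    linarith
  rw [abs_lt] at hui
  constructor
  · have h' : (-(⌊T⌋₊ : ℝ) - 1) < (u i : ℝ) := by linarith [hui.1]
    have h'' : (-(⌊T⌋₊ : ℤ) - 1 : ℤ) < u i := by exact_mod_cast h'
    omega
  · have h' : (u i : ℝ) < (⌊T⌋₊ : ℝ) + 1 := by linarith [hui.2]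
    have h'' : u i < (⌊T⌋₊ : ℤ) + 1 := by exact_mod_cast h'
    omega

/-! ## Block counting: the `min 1` branch of (HB) -/

/-- **BLOCK COUNTING.**  For `k ≥ 1` and a finite quad family `F` there is `C = C_F ≥ 0` with
`∑_{u ∈ U} M_k(ρ',c)(Rel k m F η u D) ≤ C (D + η⁻¹)²` for all parameters `ρ', c`, all `η > 0`,
`D ≥ 1` and finite `U ⊆ ℤ²`: each term is at most `1` and vanishes unless `u` lies in the lattice
box of radius `⌊(ρ+1)/η + 3(D+1)⌋₊` (`mem_box_of_Rel_nonempty`), which has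
`(2⌊…⌋₊ + 1)² ≤ (2ρ+15)² (D + η⁻¹)²` sites (`card_box`).  No quad regularity is used. -/
theorem sum_real_Rel_le {k : ℕ} (hk : 0 < k) (m : ℕ) (F : Fin m → Quad (univ : Set ℂ)) :
    ∃ C : ℝ, 0 ≤ C ∧ ∀ (ρ' c η : ℝ), 0 < η → ∀ (D : ℕ), 1 ≤ D → ∀ U : Finset (Site 2),
      ∑ u ∈ U, (M k ρ' c).real (Rel k m F η u D) ≤ C * ((D : ℝ) + η⁻¹) ^ 2 := by
  obtain ⟨ρ, hρ0, hρ⟩ := exists_carrier_subset_closedBall m F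
  refine ⟨(2 * ρ + 15) ^ 2, by positivity, fun ρ' c η hη D hD U => ?_⟩
  haveI := isProbabilityMeasure_M k ρ' c
  set N : ℕ := ⌊(ρ + 1) / η + 3 * (D + 1)⌋₊ with hN
  -- each term is bounded by the indicator of the box
  have hterm : ∀ u ∈ U,
      (M k ρ' c).real (Rel k m F η u D) ≤ if u ∈ box 2 N then (1 : ℝ) else 0 := by
    intro u _
    split_ifs with hu
    · exact measureReal_le_one
    · have hempty : Rel k m F η u D = ∅ := by
        by_contra hne
        exact hu (mem_box_of_Rel_nonempty hρ hk hη u D (Set.nonempty_iff_ne_empty.2 hne))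
      rw [hempty, measureReal_empty]
  have hsum : ∑ u ∈ U, (M k ρ' c).real (Rel k m F η u D) ≤ ((box 2 N).card : ℝ) :=
    calc ∑ u ∈ U, (M k ρ' c).real (Rel k m F η u D)
        ≤ ∑ u ∈ U, (if u ∈ box 2 N then (1 : ℝ) else 0) := Finset.sum_le_sum hterm
      _ = ((U.filter (fun u => u ∈ box 2 N)).card : ℝ) := by rw [Finset.sum_boole]
      _ ≤ ((box 2 N).card : ℝ) := by
          exact_mod_cast Finset.card_le_card (fun u hu => (Finset.mem_filter.1 hu).2)
  have hcard : ((box 2 N).card : ℝ) = (2 * N + 1) ^ 2 := by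
    rw [card_box]; push_cast; ring
  have hD1 : (1 : ℝ) ≤ D := by exact_mod_cast hD
  have hηinv : 0 < η⁻¹ := inv_pos.2 hη
  have hNle : (N : ℝ) ≤ (ρ + 1) / η + 3 * (D + 1) := Nat.floor_le (by positivity)
  have h2N : 2 * (N : ℝ) + 1 ≤ (2 * ρ + 15) * ((D : ℝ) + η⁻¹) := by
    rw [div_eq_mul_inv] at hNle
    nlinarith [mul_nonneg hρ0 (zero_le_one.trans hD1), hηinv.le, hD1]
  calc ∑ u ∈ U, (M k ρ' c).real (Rel k m F η u D)
      ≤ (2 * N + 1) ^ 2 := hsum.trans_eq hcard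
    _ ≤ ((2 * ρ + 15) * ((D : ℝ) + η⁻¹)) ^ 2 := by gcongr
    _ = (2 * ρ + 15) ^ 2 * ((D : ℝ) + η⁻¹) ^ 2 := by ring

/-- **THE `min 1` BRANCH OF (HB).**  For `k ≥ 1` and a finite quad family `F` there is `C₀ ≥ 0`
with `∑_{u ∈ U} M_k(ρ',c)(Rel k m F η u D) ≤ C₀ D²` for all parameters, all `η > 0`, all lattice
scales `D` with `Dη ≥ 1` and all finite `U` — the FULL sum, not only the blocks near the quad
boundaries (`C₀ = 4 C_F`, since `η⁻¹ ≤ D`). -/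
theorem sum_real_Rel_le_sq {k : ℕ} (hk : 0 < k) (m : ℕ) (F : Fin m → Quad (univ : Set ℂ)) :
    ∃ C₀ : ℝ, 0 ≤ C₀ ∧ ∀ (ρ' c η : ℝ), 0 < η → ∀ (D : ℕ), 1 ≤ (D : ℝ) * η → ∀ U : Finset (Site 2),
      ∑ u ∈ U, (M k ρ' c).real (Rel k m F η u D) ≤ C₀ * (D : ℝ) ^ 2 := by
  obtain ⟨C, hC0, hC⟩ := sum_real_Rel_le hk m F
  refine ⟨4 * C, by positivity, fun ρ' c η hη D hDη U => ?_⟩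
  have hD1 : 1 ≤ D := Nat.one_le_iff_ne_zero.2 (by rintro rfl; norm_num at hDη)
  have hηinv : η⁻¹ ≤ D := by
    rw [inv_eq_one_div, div_le_iff₀ hη]
    exact hDη
  calc ∑ u ∈ U, (M k ρ' c).real (Rel k m F η u D)
      ≤ C * ((D : ℝ) + η⁻¹) ^ 2 := hC ρ' c η hη D hD1 U
    _ ≤ C * ((D : ℝ) + D) ^ 2 := by gcongr
    _ = 4 * C * (D : ℝ) ^ 2 := by ring

/-! ## (HB) from its restriction to the scales below `1/η` -/

/-- **BOUNDARY RELEVANCE FROM THE SMALL SCALES** (registered helper of `stub_boundaryRelevance`,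
line `far-field-is-a-quarter-turn`).  For `k ≥ 1`, any parameter path `γ` and any finite quad
family `F`: if the boundary relevance sum obeys `∑_{u ∈ U, bdist u < 2Dη} M_k(γ s)(Rel u D) ≤ C D² (Dη)^b`
(`b > 0`) at the lattice scales `D ≥ 1` with `Dη < 1`, uniformly in `s`, small `η` and finite `U`,
then (HB) holds verbatim (the hypothesis `hB` of `weightedPivotalMass_of_factorisation` and
`sixArmSectorMass_corrected`): the scales `Dη ≥ 1` are block counting (`sum_real_Rel_le_sq`),
where `min 1 ((Dη)^b) = 1`; below, `min 1 ((Dη)^b) = (Dη)^b`. -/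
theorem boundaryRelevance_of_small_scales {k : ℕ} (hk : 0 < k) (γ : unitInterval → ℝ × ℝ) (m : ℕ)
    (F : Fin m → Quad (univ : Set ℂ))
    (h : ∃ b C η₀ : ℝ, 0 < b ∧ 0 < η₀ ∧ ∀ (s : unitInterval), ∀ η ∈ Set.Ioo (0 : ℝ) η₀, ∀ (D : ℕ),
        1 ≤ D → (D : ℝ) * η < 1 → ∀ U : Finset (Site 2),
          ∑ u ∈ U.filter (fun u => bdist k m F η u < 2 * D * η),
            (M k (γ s).1 (γ s).2).real (Rel k m F η u D) ≤ C * (D : ℝ) ^ 2 * ((D : ℝ) * η) ^ b) :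
    ∃ b C₀ η₀ : ℝ, 0 < b ∧ 0 < η₀ ∧ ∀ (s : unitInterval), ∀ η ∈ Set.Ioo (0 : ℝ) η₀, ∀ (D : ℕ),
      1 ≤ D → ∀ U : Finset (Site 2),
        ∑ u ∈ U.filter (fun u => bdist k m F η u < 2 * D * η),
          (M k (γ s).1 (γ s).2).real (Rel k m F η u D) ≤
            C₀ * (D : ℝ) ^ 2 * min 1 (((D : ℝ) * η) ^ b) := by
  obtain ⟨b, C, η₀, hb, hη₀, hC⟩ := h
  obtain ⟨C₁, hC₁0, hC₁⟩ := sum_real_Rel_le_sq hk m F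
  refine ⟨b, max C 0 + C₁, η₀, hb, hη₀, fun s η hη D hD U => ?_⟩
  have hη0 : 0 < η := hη.1
  have hD0 : (0 : ℝ) < D := by exact_mod_cast hD
  have hx : 0 < (D : ℝ) * η := by positivity
  have hD2 : (0 : ℝ) ≤ (D : ℝ) ^ 2 := by positivity
  rcases lt_or_ge ((D : ℝ) * η) 1 with hlt | hge
  · -- small scales: the hypothesis
    have hmin : min 1 (((D : ℝ) * η) ^ b) = ((D : ℝ) * η) ^ b :=
      min_eq_right (Real.rpow_le_one hx.le hlt.le hb.le)
    rw [hmin]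
    have h1 : C ≤ max C 0 + C₁ := by linarith [le_max_left C 0]
    have h2 : (0 : ℝ) ≤ ((D : ℝ) * η) ^ b := by positivity
    calc ∑ u ∈ U.filter (fun u => bdist k m F η u < 2 * D * η),
          (M k (γ s).1 (γ s).2).real (Rel k m F η u D)
        ≤ C * (D : ℝ) ^ 2 * ((D : ℝ) * η) ^ b := hC s η hη D hD hlt U
      _ ≤ (max C 0 + C₁) * (D : ℝ) ^ 2 * ((D : ℝ) * η) ^ b :=
          mul_le_mul_of_nonneg_right (mul_le_mul_of_nonneg_right h1 hD2) h2
  · -- large scales: block counting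
    have hmin : min 1 (((D : ℝ) * η) ^ b) = 1 := min_eq_left (Real.one_le_rpow hge hb.le)
    rw [hmin, mul_one]
    have h1 : C₁ ≤ max C 0 + C₁ := by linarith [le_max_right C 0]
    calc ∑ u ∈ U.filter (fun u => bdist k m F η u < 2 * D * η),
          (M k (γ s).1 (γ s).2).real (Rel k m F η u D)
        ≤ ∑ u ∈ U, (M k (γ s).1 (γ s).2).real (Rel k m F η u D) :=
          Finset.sum_le_sum_of_subset_of_nonneg (Finset.filter_subset _ _)
            fun _ _ _ => measureReal_nonneg
      _ ≤ C₁ * (D : ℝ) ^ 2 := hC₁ (γ s).1 (γ s).2 η hη0 D hge U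
      _ ≤ (max C 0 + C₁) * (D : ℝ) ^ 2 := mul_le_mul_of_nonneg_right h1 hD2

/-! ## A sufficient condition for the small scales: boundary count times uniform decay -/

/-- **SMALL-SCALE BOUNDARY RELEVANCE FROM A BLOCK COUNT AND A UNIFORM PER-BOX DECAY.**  If, at
the scales `D ≥ 1`, `Dη < 1` (small `η`), (i) the number of blocks of `U` within plane distance
`2Dη` of the quad boundaries is `≤ L D η⁻¹` (a finite upper Minkowski content of `∂F`: `O(D/η)`
centres of the lattice `η√2k ℤ²` in the `2Dη`-neighbourhood of a rectifiable boundary), and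
(ii) every such block has `M_k(γ s)(Rel u D) ≤ C (Dη)^{1+b}` (`b > 0`: the boundary analogue of
`x₄ > 1`, i.e. a half-plane three-arm exponent `> 1`, uniformly along the path), then the boundary
relevance sum is `≤ (L⁺C⁺) D² (Dη)^b` — the hypothesis of `boundaryRelevance_of_small_scales`. -/
theorem boundaryRelevance_small_of_count_of_decay {k : ℕ} (γ : unitInterval → ℝ × ℝ) (m : ℕ)
    (F : Fin m → Quad (univ : Set ℂ))
    (hcount : ∃ L η₁ : ℝ, 0 < η₁ ∧ ∀ η ∈ Set.Ioo (0 : ℝ) η₁, ∀ (D : ℕ), 1 ≤ D → (D : ℝ) * η < 1 →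
        ∀ U : Finset (Site 2),
          ((U.filter (fun u => bdist k m F η u < 2 * D * η)).card : ℝ) ≤ L * D * η⁻¹)
    (hdecay : ∃ b C η₂ : ℝ, 0 < b ∧ 0 < η₂ ∧ ∀ (s : unitInterval), ∀ η ∈ Set.Ioo (0 : ℝ) η₂,
        ∀ (D : ℕ), 1 ≤ D → (D : ℝ) * η < 1 → ∀ u : Site 2, bdist k m F η u < 2 * D * η →
          (M k (γ s).1 (γ s).2).real (Rel k m F η u D) ≤ C * ((D : ℝ) * η) ^ (1 + b)) :
    ∃ b C η₀ : ℝ, 0 < b ∧ 0 < η₀ ∧ ∀ (s : unitInterval), ∀ η ∈ Set.Ioo (0 : ℝ) η₀, ∀ (D : ℕ),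
      1 ≤ D → (D : ℝ) * η < 1 → ∀ U : Finset (Site 2),
        ∑ u ∈ U.filter (fun u => bdist k m F η u < 2 * D * η),
          (M k (γ s).1 (γ s).2).real (Rel k m F η u D) ≤ C * (D : ℝ) ^ 2 * ((D : ℝ) * η) ^ b := by
  obtain ⟨L, η₁, hη₁, hL⟩ := hcount
  obtain ⟨b, C, η₂, hb, hη₂, hC⟩ := hdecay
  refine ⟨b, max L 0 * max C 0, min η₁ η₂, hb, lt_min hη₁ hη₂, fun s η hη D hD hDη U => ?_⟩
  have hη0 : 0 < η := hη.1
  have hηne : η ≠ 0 := hη0.ne'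
  have hη1 : η ∈ Set.Ioo (0 : ℝ) η₁ := ⟨hη0, lt_of_lt_of_le hη.2 (min_le_left _ _)⟩
  have hη2 : η ∈ Set.Ioo (0 : ℝ) η₂ := ⟨hη0, lt_of_lt_of_le hη.2 (min_le_right _ _)⟩
  have hD0 : (0 : ℝ) < D := by exact_mod_cast hD
  have hx : 0 < (D : ℝ) * η := by positivity
  set S := U.filter (fun u => bdist k m F η u < 2 * D * η) with hS
  have hterm : ∀ u ∈ S,
      (M k (γ s).1 (γ s).2).real (Rel k m F η u D) ≤ max C 0 * ((D : ℝ) * η) ^ (1 + b) := by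
    intro u hu
    have hu' := (Finset.mem_filter.1 hu).2
    calc (M k (γ s).1 (γ s).2).real (Rel k m F η u D)
        ≤ C * ((D : ℝ) * η) ^ (1 + b) := hC s η hη2 D hD hDη u hu'
      _ ≤ max C 0 * ((D : ℝ) * η) ^ (1 + b) :=
          mul_le_mul_of_nonneg_right (le_max_left _ _) (by positivity)
  have hcard : (S.card : ℝ) ≤ max L 0 * D * η⁻¹ :=
    calc (S.card : ℝ) ≤ L * D * η⁻¹ := hL η hη1 D hD hDη U
      _ ≤ max L 0 * D * η⁻¹ :=
          mul_le_mul_of_nonneg_right (mul_le_mul_of_nonneg_right (le_max_left L 0) hD0.le)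
            (inv_nonneg.2 hη0.le)
  calc ∑ u ∈ S, (M k (γ s).1 (γ s).2).real (Rel k m F η u D)
      ≤ S.card • (max C 0 * ((D : ℝ) * η) ^ (1 + b)) := Finset.sum_le_card_nsmul _ _ _ hterm
    _ = (S.card : ℝ) * (max C 0 * ((D : ℝ) * η) ^ (1 + b)) := by rw [nsmul_eq_mul]
    _ ≤ (max L 0 * D * η⁻¹) * (max C 0 * ((D : ℝ) * η) ^ (1 + b)) :=
        mul_le_mul_of_nonneg_right hcard (by positivity)
    _ = max L 0 * max C 0 * (D : ℝ) ^ 2 * ((D : ℝ) * η) ^ b := by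
        rw [Real.rpow_add hx, Real.rpow_one]
        have hinv : η⁻¹ * η = 1 := inv_mul_cancel₀ hηne
        calc max L 0 * D * η⁻¹ * (max C 0 * ((D : ℝ) * η * ((D : ℝ) * η) ^ b))
            = max L 0 * max C 0 * (D : ℝ) ^ 2 * ((D : ℝ) * η) ^ b * (η⁻¹ * η) := by ring
          _ = max L 0 * max C 0 * (D : ℝ) ^ 2 * ((D : ℝ) * η) ^ b := by rw [hinv, mul_one]

end Summit.CriticalPhenomena.CardyFormulaZ2.Theorems.CardySelfRefinement.FarField

end
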